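import Literature.MathematicalPhysics.QuantumLattice.FermionQuasiFreeWick
import Literature.MathematicalPhysics.QuantumLattice.FermionQuasiFreeDynamics
import HarnessLib

/-!
# Quasi-free Gibbs states of lattice fermions, IV: the thermal Wick theorem in time-ordered
determinant form (linear letters, interleaved words, evolved fields)

Topic `MathematicalPhysics/QuantumLattice`; continuation of `FermionQuasiFreeWick.lean` (Gaudin's
recursion `⟨l a₀⋯a_{m-1}⟩ = Σ_k (-1)^k ⟨l a_k⟩⟨a₀⋯â_k⋯a_{m-1}⟩` for Jordan–Wigner LETTERS and the
determinant formula for NESTED words `c†⋯c†c⋯c`) and `FermionQuasiFreeDynamics.lean` (the free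
propagator at unequal imaginary times). Programme under the tree's fact `bgm_two_point_limit`
(`HubbardFermiLiquid.lean`): Benfatto–Giuliani–Mastropietro (Ann. Henri Poincaré 7 (2006) 809)
start from the statement that at `U = 0` "the Schwinger functions of any order `n` can be exactly
computed as linear combinations of products of two–point Schwinger functions (via the well–known
Wick rule)" (§1.2, after (1.3), p. 2 of the held arXiv text), with the time ordering (1.3) and its
sign, and from the fact that "the usual formal power series in `U` for the partition function and
for the Schwinger functions … can be equivalently rewritten in terms of Grassmann functional
integrals" (§2.1, p. 5; (2.6), (2.8)), i.e. as determinants of free propagators. The operator-side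
content of both statements at every order is the theorem proved here: **the Gibbs state of a
quadratic Hamiltonian `dΓ(h)` evaluated on an alternating product of (smeared, imaginary-time
evolved) creation and annihilation operators is the determinant of the matrix of time-ordered
two-point functions.** Everything is PROVED; no physical definition and no named fact is
introduced (the new `def`s are combinatorial bookkeeping: interleaved words, their sign and
contraction matrix, linear letters and their words).

* §1 Interleaved words (`interleaveWord m n u v k`: the arrangement of `u₀…u_{m-1}` and
  `v₀…v_{n-1}` with `k b` letters `u` before `v_b`), deleted words, positions, and the splitting
  of the alternating sum `fermiWickSum` along such a word (`fermiWickSum_interleaveWord`).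
* §2 **The determinant formula for a Gaudin functional**
  (`gaudinFunctional_interleaveWord_eq_sign_mul_det`): if `φ` satisfies Gaudin's recursion,
  `φ(∅) = 1`, and equal-kind contractions vanish, then for EVERY interleaving
  `φ(word) = (-1)^{Σ_b (k_b + b + 1)} · det [u_a before v_b ? φ(u_a v_b) : -φ(v_b u_a)]`
  (Gaudin's recursion on the first letter is the Laplace expansion along the first row or column;
  the class of interleavings is the smallest one closed under the recursion). This is the
  Pfaffian of Gaudin's theorem for a charge-balanced word, written as a determinant with the
  fermionic ordering sign inside the entries.
* §3 **Linear letters** `c^b(f) = Σ_i f_i c^b_i` (`linLetterOp`; Bratteli–Robinson's `a*(f)`, `a(f)`,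
  here both linear in `f`): CAR (`linLetterOp_mul_add_mul`), graded commutator with a word,
  pull-through `c^b(f) e^{-βdΓ(h)} = e^{-βdΓ(h)} c^b(f P⁽ᵇ⁾)`, Gaudin's linear system and
  **Gaudin's recursion for words of linear letters** (`gibbsState_dGamma_linLetterOp_mul_linWordOp`,
  reusing `gaudin_solve` of part II), vanishing of equal-type contractions; hence the determinant
  formula for interleaved (`gibbsState_dGamma_linWordOp_interleaveWord`) and alternating
  (`gibbsState_dGamma_prod_linLetterOp_eq_det`, sign `+1`) words of linear letters.
* §4 **The time-ordered Wick theorem** (`gibbsState_dGamma_prod_evolved_eq_det`): the evolved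
  fields `e^{s dΓ(h)} c^±_i e^{-s dΓ(h)}` are linear letters (part I), so
  `⟨a⁺_{i₀}(s₀)a⁻_{j₀}(t₀)⋯a⁺_{i_{n-1}}(s_{n-1})a⁻_{j_{n-1}}(t_{n-1})⟩_β = det G` with
  `G_{ab} = ⟨a⁺_{i_a}(s_a)a⁻_{j_b}(t_b)⟩` (`a ≤ b`), `-⟨a⁻_{j_b}(t_b)a⁺_{i_a}(s_a)⟩` (`a > b`), given in
  closed Fermi-matrix form by part III — for times decreasing along the word these are
  `-g(𝐱_b-𝐲_a)` with BGM's propagator (1.3)–(1.4), creation before annihilation at equal times as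
  in BGM's footnote 1; and the equal-time case `⟨(c†_{i₀}c_{j₀})⋯(c†_{i_{n-1}}c_{j_{n-1}})⟩`
  (`gibbsState_dGamma_prod_creation_mul_annihilation_eq_det`, density correlations of the ideal
  Fermi gas).

Not here: the Dyson/Duhamel expansion of the interacting Gibbs state in `U` (`DysonExpansion.lean`)
combined with §4 into BGM's (2.8) for the Hubbard interaction, and the `M → ∞` Grassmann statement
(2.6) itself.

## Mathlib / tree search

Mathlib: `Matrix.det_succ_row_zero`, `Matrix.det_succ_column_zero`, the `Fin.succAbove` API,
`Matrix.single_one_vecMul`; no Wick/Pfaffian/quasi-free theorem (`lean search 'Pfaffian|Wick'`: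
nothing fermionic). Tree: parts I–III (`FermionQuasiFree`; `FermionQuasiFreeWick`: `fermiWickSum`,
`fermiWickSum_ofFn`, `letterOp_mul_add_mul`, `letterOp_mul_gibbsWeight_dGamma`, `gaudin_solve`,
`trace_gibbsWeight_dGamma_letterOp_same`; `FermionQuasiFreeDynamics`: the two-time propagators).

## References

* M. Gaudin, *Une démonstration simplifiée du théorème de Wick en mécanique statistique*,
  Nucl. Phys. 15 (1960) 89–91 (the recursion for `⟨α₁⋯α_{2n}⟩` with `α_i` arbitrary linear
  combinations of creation and annihilation operators, and its iteration). [Gaudin1960]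
* O. Bratteli, D. W. Robinson, *Operator Algebras and Quantum Statistical Mechanics 2*, 2nd ed.
  (Springer 1997), §5.2.1 (CAR, `a(f)`), §5.2.4 (gauge-invariant quasi-free states are determined
  by the two-point function; the ideal Fermi gas). [BratteliRobinsonII1997]
* G. Benfatto, A. Giuliani, V. Mastropietro, Ann. Henri Poincaré 7 (2006) 809–898, §1.2
  (1.2)–(1.4) and footnote 1, §2.1 (2.6)–(2.8) (arXiv:cond-mat/0507686, pp. 2, 5–6 of the held
  text). [BenfattoGiulianiMastropietro2006]
-/

noncomputable section

namespace Literature.MathematicalPhysics.QuantumLattice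

open NormedSpace Matrix Finset
open scoped ComplexOrder

/-! ### Interleaved words -/

section Interleave

variable {X : Type*}

/-- The interleaving of the letters `u₀, …, u_{m-1}` and `v₀, …, v_{n-1}` (each family in its own
order) in which `v_b` is preceded by exactly `k b` of the `u`'s (for `k` monotone with `k b ≤ m`).
Every arrangement of `m` letters of one kind and `n` of another is of this form. [folklore] -/
def interleaveWord : (m n : ℕ) → (Fin m → X) → (Fin n → X) → (Fin n → ℕ) → List X
  | _, 0, u, _, _ => List.ofFn u
  | 0, _ + 1, _, v, _ => List.ofFn v
  | m + 1, n + 1, u, v, k =>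
      if k 0 = 0 then v 0 :: interleaveWord (m + 1) n u (Fin.tail v) (Fin.tail k)
      else u 0 :: interleaveWord m (n + 1) (Fin.tail u) v (fun b => k b - 1)
termination_by m n => m + n

/-- No `v`'s: the word is `u₀ ⋯ u_{m-1}`. [folklore] -/
@[simp] theorem interleaveWord_zero_right (m : ℕ) (u : Fin m → X) (v : Fin 0 → X) (k : Fin 0 → ℕ) :
    interleaveWord m 0 u v k = List.ofFn u := by
  simp [interleaveWord]

/-- No `u`'s: the word is `v₀ ⋯ v_{n-1}`. [folklore] -/
@[simp] theorem interleaveWord_zero_left (n : ℕ) (u : Fin 0 → X) (v : Fin n → X) (k : Fin n → ℕ) :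
    interleaveWord 0 n u v k = List.ofFn v := by
  cases n with
  | zero => simp
  | succ n => simp [interleaveWord]

/-- The defining recursion when both kinds of letters are present. [folklore] -/
theorem interleaveWord_succ_succ (m n : ℕ) (u : Fin (m + 1) → X) (v : Fin (n + 1) → X)
    (k : Fin (n + 1) → ℕ) :
    interleaveWord (m + 1) (n + 1) u v k =
      if k 0 = 0 then v 0 :: interleaveWord (m + 1) n u (Fin.tail v) (Fin.tail k)
      else u 0 :: interleaveWord m (n + 1) (Fin.tail u) v (fun b => k b - 1) := by
  rw [interleaveWord]

/-- If `k 0 = 0` the word starts with `v₀`. [folklore] -/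
theorem interleaveWord_consV {m n : ℕ} (u : Fin m → X) (v : Fin (n + 1) → X) {k : Fin (n + 1) → ℕ}
    (h : k 0 = 0) :
    interleaveWord m (n + 1) u v k = v 0 :: interleaveWord m n u (Fin.tail v) (Fin.tail k) := by
  cases m with
  | zero =>
    rw [interleaveWord_zero_left, interleaveWord_zero_left, List.ofFn_succ]
    rfl
  | succ m => rw [interleaveWord_succ_succ, if_pos h]

/-- If no `k b` vanishes (in particular if there is no `v`) the word starts with `u₀`. [folklore] -/
theorem interleaveWord_consU {m n : ℕ} (u : Fin (m + 1) → X) (v : Fin n → X) {k : Fin n → ℕ}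
    (h : ∀ b, k b ≠ 0) :
    interleaveWord (m + 1) n u v k = u 0 :: interleaveWord m n (Fin.tail u) v (fun b => k b - 1) := by
  cases n with
  | zero =>
    rw [interleaveWord_zero_right, interleaveWord_zero_right, List.ofFn_succ]
    rfl
  | succ n => rw [interleaveWord_succ_succ, if_neg (h 0)]

/-- The interleaved word has `m + n` letters. [folklore] -/
theorem length_interleaveWord : ∀ (m n : ℕ) (u : Fin m → X) (v : Fin n → X) (k : Fin n → ℕ),
    (interleaveWord m n u v k).length = m + n
  | _, 0, u, _, _ => by simp
  | 0, n + 1, _, v, _ => by simp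
  | m + 1, n + 1, u, v, k => by
    rw [interleaveWord_succ_succ]
    split_ifs
    · rw [List.length_cons, length_interleaveWord]; omega
    · rw [List.length_cons, length_interleaveWord]; omega
termination_by m n => m + n


/-- The word with the letter `v_b` deleted (an interleaving of `m` and `n - 1` letters).
[folklore] -/
def interleaveDelV : (m n : ℕ) → (Fin m → X) → (Fin n → X) → (Fin n → ℕ) → Fin n → List X
  | _, 0, _, _, _, b => b.elim0
  | m, n + 1, u, v, k, b =>
      interleaveWord m n u (fun b' => v (b.succAbove b')) (fun b' => k (b.succAbove b'))

/-- The word with the letter `u_a` deleted (an interleaving of `m - 1` and `n` letters: every `v`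
that came after `u_a` has one `u` fewer in front of it). [folklore] -/
def interleaveDelU : (m n : ℕ) → (Fin m → X) → (Fin n → X) → (Fin n → ℕ) → Fin m → List X
  | 0, _, _, _, _, a => a.elim0
  | m + 1, n, u, v, k, a =>
      interleaveWord m n (fun a' => u (a.succAbove a')) v
        (fun b => k b - if (a : ℕ) < k b then 1 else 0)

/-- The position of `v_b` in the word: `k b` letters `u` and `b` letters `v` precede it.
[folklore] -/
def interleavePosV {n : ℕ} (k : Fin n → ℕ) (b : Fin n) : ℕ := k b + b

/-- The position of `u_a` in the word: `a` letters `u` and the `v_b` with `k b ≤ a` precede it.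
[folklore] -/
def interleavePosU {m n : ℕ} (k : Fin n → ℕ) (a : Fin m) : ℕ :=
  a + (univ.filter fun b => k b ≤ (a : ℕ)).card

/-- `interleaveDelV` unfolded. [folklore] -/
@[simp] theorem interleaveDelV_succ (m n : ℕ) (u : Fin m → X) (v : Fin (n + 1) → X)
    (k : Fin (n + 1) → ℕ) (b : Fin (n + 1)) :
    interleaveDelV m (n + 1) u v k b =
      interleaveWord m n u (fun b' => v (b.succAbove b')) (fun b' => k (b.succAbove b')) := rfl

/-- `interleaveDelU` unfolded. [folklore] -/
@[simp] theorem interleaveDelU_succ (m n : ℕ) (u : Fin (m + 1) → X) (v : Fin n → X)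
    (k : Fin n → ℕ) (a : Fin (m + 1)) :
    interleaveDelU (m + 1) n u v k a =
      interleaveWord m n (fun a' => u (a.succAbove a')) v
        (fun b => k b - if (a : ℕ) < k b then 1 else 0) := rfl

/-- Monotonicity passes to the tail. [folklore] -/
theorem monotone_fin_tail {n : ℕ} {k : Fin (n + 1) → ℕ} (hk : Monotone k) : Monotone (Fin.tail k) :=
  fun _ _ hab => hk (Fin.succ_le_succ_iff.mpr hab)

/-- Deleting `v₀` from a word starting with `v₀` leaves the tail. [folklore] -/
theorem interleaveDelV_zero {m n : ℕ} (u : Fin m → X) (v : Fin (n + 1) → X) (k : Fin (n + 1) → ℕ) :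
    interleaveDelV m (n + 1) u v k 0 = interleaveWord m n u (Fin.tail v) (Fin.tail k) := by
  simp only [interleaveDelV_succ, Fin.zero_succAbove]
  rfl

/-- Deleting `u₀` from a word starting with `u₀` leaves the tail. [folklore] -/
theorem interleaveDelU_zero {m n : ℕ} (u : Fin (m + 1) → X) (v : Fin n → X) {k : Fin n → ℕ}
    (h1 : ∀ b, k b ≠ 0) :
    interleaveDelU (m + 1) n u v k 0 = interleaveWord m n (Fin.tail u) v (fun b => k b - 1) := by
  rw [interleaveDelU_succ]
  congr 1
  funext b
  rw [Fin.val_zero, if_pos (Nat.pos_of_ne_zero (h1 b))]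

/-- Deleting a later `v` from a word starting with `v₀` commutes with removing `v₀`. [folklore] -/
theorem interleaveDelV_succ_of_zero {m n : ℕ} (u : Fin m → X) (v : Fin (n + 1) → X)
    {k : Fin (n + 1) → ℕ} (h0 : k 0 = 0) (b : Fin n) :
    interleaveDelV m (n + 1) u v k b.succ =
      v 0 :: interleaveDelV m n u (Fin.tail v) (Fin.tail k) b := by
  cases n with
  | zero => exact b.elim0
  | succ n =>
    rw [interleaveDelV_succ, interleaveDelV_succ,
      interleaveWord_consV u _ (k := fun b' => k (b.succ.succAbove b')) (by simp [h0])]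
    simp only [Fin.succ_succAbove_zero]
    congr 2 <;> funext i <;> simp [Fin.tail, Fin.succ_succAbove_succ]

/-- Deleting a `u` from a word starting with `v₀` commutes with removing `v₀`. [folklore] -/
theorem interleaveDelU_of_zero {m n : ℕ} (u : Fin m → X) (v : Fin (n + 1) → X)
    {k : Fin (n + 1) → ℕ} (h0 : k 0 = 0) (a : Fin m) :
    interleaveDelU m (n + 1) u v k a =
      v 0 :: interleaveDelU m n u (Fin.tail v) (Fin.tail k) a := by
  cases m with
  | zero => exact a.elim0
  | succ m =>
    rw [interleaveDelU_succ, interleaveDelU_succ,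
      interleaveWord_consV _ v (k := fun b => k b - if (a : ℕ) < k b then 1 else 0) (by simp [h0])]
    rfl

/-- Deleting a later `u` from a word starting with `u₀` commutes with removing `u₀`. [folklore] -/
theorem interleaveDelU_succ_of_ne_zero {m n : ℕ} (u : Fin (m + 1) → X) (v : Fin n → X)
    {k : Fin n → ℕ} (h1 : ∀ b, k b ≠ 0) (a : Fin m) :
    interleaveDelU (m + 1) n u v k a.succ =
      u 0 :: interleaveDelU m n (Fin.tail u) v (fun b => k b - 1) a := by
  cases m with
  | zero => exact a.elim0
  | succ m =>
    rw [interleaveDelU_succ, interleaveDelU_succ,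
      interleaveWord_consU _ v (k := fun b => k b - if ((a.succ : Fin (m + 2)) : ℕ) < k b then 1 else 0)
        (fun b => by have := h1 b; simp only [Fin.val_succ]; split_ifs <;> omega)]
    simp only [Fin.succ_succAbove_zero, Fin.val_succ]
    congr 2
    · funext a'
      simp [Fin.tail, Fin.succ_succAbove_succ]
    · funext b
      have := h1 b
      split_ifs <;> omega

/-- Deleting a `v` from a word starting with `u₀` commutes with removing `u₀`. [folklore] -/
theorem interleaveDelV_of_ne_zero {m n : ℕ} (u : Fin (m + 1) → X) (v : Fin n → X)
    {k : Fin n → ℕ} (h1 : ∀ b, k b ≠ 0) (b : Fin n) :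
    interleaveDelV (m + 1) n u v k b =
      u 0 :: interleaveDelV m n (Fin.tail u) v (fun b => k b - 1) b := by
  cases n with
  | zero => exact b.elim0
  | succ n =>
    rw [interleaveDelV_succ, interleaveDelV_succ,
      interleaveWord_consU u _ (k := fun b' => k (b.succAbove b')) (fun b' => h1 _)]

/-- Position of a later `v` in a word starting with `v₀`. [folklore] -/
theorem interleavePosV_succ {n : ℕ} (k : Fin (n + 1) → ℕ) (b : Fin n) :
    interleavePosV k b.succ = interleavePosV (Fin.tail k) b + 1 := by
  simp only [interleavePosV, Fin.tail, Fin.val_succ]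
  omega

/-- Position of a `v` in a word starting with `u₀`. [folklore] -/
theorem interleavePosV_of_ne_zero {n : ℕ} {k : Fin n → ℕ} (h1 : ∀ b, k b ≠ 0) (b : Fin n) :
    interleavePosV k b = interleavePosV (fun b => k b - 1) b + 1 := by
  simp only [interleavePosV]
  have := h1 b
  omega

/-- Position of a `u` in a word starting with `v₀`. [folklore] -/
theorem interleavePosU_of_zero {m n : ℕ} {k : Fin (n + 1) → ℕ} (h0 : k 0 = 0) (a : Fin m) :
    interleavePosU k a = interleavePosU (Fin.tail k) a + 1 := by
  simp only [interleavePosU, Finset.card_filter, Fin.sum_univ_succ, h0, zero_le, if_true, Fin.tail]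
  omega

/-- The first `u` of a word starting with `u₀` sits at position `0`. [folklore] -/
theorem interleavePosU_zero_of_ne_zero {m n : ℕ} {k : Fin n → ℕ} (h1 : ∀ b, k b ≠ 0) :
    interleavePosU k (0 : Fin (m + 1)) = 0 := by
  simp only [interleavePosU, Fin.val_zero, zero_add, Finset.card_eq_zero,
    Finset.filter_eq_empty_iff, Finset.mem_univ, true_implies, Nat.le_zero]
  exact fun b => h1 b

/-- Position of a later `u` in a word starting with `u₀`. [folklore] -/
theorem interleavePosU_succ_of_ne_zero {m n : ℕ} {k : Fin n → ℕ} (h1 : ∀ b, k b ≠ 0)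
    (a : Fin m) :
    interleavePosU k (a.succ : Fin (m + 1)) = interleavePosU (fun b => k b - 1) a + 1 := by
  simp only [interleavePosU, Fin.val_succ]
  have : (univ.filter fun b => k b ≤ (a : ℕ) + 1) = univ.filter fun b => k b - 1 ≤ (a : ℕ) :=
    Finset.filter_congr fun b _ => by have := h1 b; omega
  rw [this]
  omega

/-- **Splitting the alternating sum along an interleaved word** into the contributions of the
`v`-letters and of the `u`-letters, each with its position sign and its deleted word.
[folklore] -/
theorem fermiWickSum_interleaveWord {M : Type*} [AddCommGroup M] (F : X → List X → M) :
    ∀ (m n : ℕ) (u : Fin m → X) (v : Fin n → X) (k : Fin n → ℕ), Monotone k → (∀ b, k b ≤ m) →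
      ∀ pre : List X, fermiWickSum F pre (interleaveWord m n u v k) =
        ∑ b, (-1 : ℤ) ^ interleavePosV k b • F (v b) (pre ++ interleaveDelV m n u v k b) +
          ∑ a, (-1 : ℤ) ^ interleavePosU k a • F (u a) (pre ++ interleaveDelU m n u v k a)
  | 0, 0, u, v, k, _, _, pre => by simp
  | m + 1, 0, u, v, k, _, _, pre => by
    rw [interleaveWord_zero_right, fermiWickSum_ofFn]
    simp [interleavePosU]
  | 0, n + 1, u, v, k, _, hk, pre => by
    have hk0 : ∀ b, k b = 0 := fun b => Nat.le_zero.mp (hk b)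
    rw [interleaveWord_zero_left, fermiWickSum_ofFn]
    simp [interleavePosV, hk0]
  | m + 1, n + 1, u, v, k, hmono, hk, pre => by
    by_cases h0 : k 0 = 0
    · -- the word starts with `v 0`
      have ih := fermiWickSum_interleaveWord F (m + 1) n u (Fin.tail v) (Fin.tail k)
        (monotone_fin_tail hmono) (fun b => hk b.succ) (pre ++ [v 0])
      rw [interleaveWord_consV u v h0, fermiWickSum_cons, ih]
      have eV : ∑ b : Fin (n + 1), (-1 : ℤ) ^ interleavePosV k b •
            F (v b) (pre ++ interleaveDelV (m + 1) (n + 1) u v k b) =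
          F (v 0) (pre ++ interleaveWord (m + 1) n u (Fin.tail v) (Fin.tail k)) +
            ∑ b : Fin n, -((-1 : ℤ) ^ interleavePosV (Fin.tail k) b • F (Fin.tail v b)
              (pre ++ [v 0] ++ interleaveDelV (m + 1) n u (Fin.tail v) (Fin.tail k) b)) := by
        rw [Fin.sum_univ_succ]
        congr 1
        · rw [interleaveDelV_zero]
          simp [interleavePosV, h0]
        · refine Finset.sum_congr rfl fun b _ => ?_
          rw [interleavePosV_succ, interleaveDelV_succ_of_zero u v h0, pow_succ, List.append_assoc,
            List.singleton_append]
          simp [Fin.tail]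
      have eU : ∑ a : Fin (m + 1), (-1 : ℤ) ^ interleavePosU k a •
            F (u a) (pre ++ interleaveDelU (m + 1) (n + 1) u v k a) =
          ∑ a : Fin (m + 1), -((-1 : ℤ) ^ interleavePosU (Fin.tail k) a • F (u a)
              (pre ++ [v 0] ++ interleaveDelU (m + 1) n u (Fin.tail v) (Fin.tail k) a)) := by
        refine Finset.sum_congr rfl fun a _ => ?_
        rw [interleavePosU_of_zero h0, interleaveDelU_of_zero u v h0, pow_succ, List.append_assoc,
          List.singleton_append]
        simp
      rw [eV, eU, Finset.sum_neg_distrib, Finset.sum_neg_distrib]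
      abel
    · -- the word starts with `u 0`
      have h1 : ∀ b, k b ≠ 0 := fun b =>
        Nat.one_le_iff_ne_zero.mp ((Nat.one_le_iff_ne_zero.mpr h0).trans (hmono (Fin.zero_le b)))
      have ih := fermiWickSum_interleaveWord F m (n + 1) (Fin.tail u) v (fun b => k b - 1)
        (fun a b hab => Nat.sub_le_sub_right (hmono hab) 1) (fun b => by have := hk b; omega)
        (pre ++ [u 0])
      rw [interleaveWord_consU u v h1, fermiWickSum_cons, ih]
      have eU : ∑ a : Fin (m + 1), (-1 : ℤ) ^ interleavePosU k a •
            F (u a) (pre ++ interleaveDelU (m + 1) (n + 1) u v k a) =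
          F (u 0) (pre ++ interleaveWord m (n + 1) (Fin.tail u) v (fun b => k b - 1)) +
            ∑ a : Fin m, -((-1 : ℤ) ^ interleavePosU (fun b => k b - 1) a • F (Fin.tail u a)
              (pre ++ [u 0] ++ interleaveDelU m (n + 1) (Fin.tail u) v (fun b => k b - 1) a)) := by
        rw [Fin.sum_univ_succ]
        congr 1
        · rw [interleaveDelU_zero u v h1, interleavePosU_zero_of_ne_zero h1]
          simp
        · refine Finset.sum_congr rfl fun a _ => ?_
          rw [interleavePosU_succ_of_ne_zero h1, interleaveDelU_succ_of_ne_zero u v h1, pow_succ,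
            List.append_assoc, List.singleton_append]
          simp [Fin.tail]
      have eV : ∑ b : Fin (n + 1), (-1 : ℤ) ^ interleavePosV k b •
            F (v b) (pre ++ interleaveDelV (m + 1) (n + 1) u v k b) =
          ∑ b : Fin (n + 1), -((-1 : ℤ) ^ interleavePosV (fun b => k b - 1) b • F (v b)
              (pre ++ [u 0] ++ interleaveDelV m (n + 1) (Fin.tail u) v (fun b => k b - 1) b)) := by
        refine Finset.sum_congr rfl fun b _ => ?_
        rw [interleavePosV_of_ne_zero h1, interleaveDelV_of_ne_zero u v h1, pow_succ,
          List.append_assoc, List.singleton_append]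
        simp
      rw [eV, eU, Finset.sum_neg_distrib, Finset.sum_neg_distrib]
      abel
termination_by m n => m + n

end Interleave

/-! ### The determinant formula for a Gaudin functional -/

section GaudinFunctional

variable {X : Type*}

/-- Parity transport for powers of `-1`. [folklore] -/
theorem neg_one_pow_eq_neg_one_pow_of_mod_two {R : Type*} [Ring R] {p q : ℕ}
    (h : p % 2 = q % 2) : (-1 : R) ^ p = (-1) ^ q := by
  rw [neg_one_pow_eq_pow_mod_two (R := R) (n := p), h, ← neg_one_pow_eq_pow_mod_two]

/-- Parity transport for powers of `-1`, with a sign. [folklore] -/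
theorem neg_one_pow_eq_neg_neg_one_pow_of_mod_two {R : Type*} [Ring R] {p q : ℕ}
    (h : p % 2 = (q + 1) % 2) : (-1 : R) ^ p = -(-1) ^ q := by
  rw [neg_one_pow_eq_neg_one_pow_of_mod_two h, pow_succ, mul_neg_one]

/-- The value of `Fin.succAbove` as a natural number. [folklore] -/
theorem val_succAbove_eq_ite {n : ℕ} (a : Fin (n + 1)) (a' : Fin n) :
    ((a.succAbove a' : Fin (n + 1)) : ℕ) = if (a' : ℕ) < a then (a' : ℕ) else (a' : ℕ) + 1 := by
  by_cases h : Fin.castSucc a' < a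
  · have h' : (a' : ℕ) < a := by rwa [Fin.lt_def, Fin.val_castSucc] at h
    rw [Fin.succAbove_of_castSucc_lt _ _ h, Fin.val_castSucc, if_pos h']
  · have h' : ¬ (a' : ℕ) < a := fun h' => h (by rw [Fin.lt_def, Fin.val_castSucc]; exact h')
    rw [Fin.succAbove_of_le_castSucc _ _ (not_lt.mp h), Fin.val_succ, if_neg h']

/-- The matrix of **ordered contractions** of an interleaved word: the entry `(a, b)` is
`φ [u_a, v_b]` if `u_a` precedes `v_b` in the word and `-φ [v_b, u_a]` otherwise (the fermionic
time-ordering sign). Gaudin, Nucl. Phys. 15 (1960) 89; BGM 2006, (1.3). [folklore] -/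
def interleaveMatrix (φ : List X → ℂ) {n : ℕ} (u v : Fin n → X) (k : Fin n → ℕ) :
    Matrix (Fin n) (Fin n) ℂ :=
  Matrix.of fun a b => if (a : ℕ) < k b then φ [u a, v b] else -φ [v b, u a]

/-- The sign of an interleaving relative to the alternating arrangement `u₀v₀u₁v₁⋯`:
`(-1)^{Σ_b (k_b + b + 1)}` (`= +1` for the alternating word `k_b = b + 1`). [folklore] -/
def interleaveSign {n : ℕ} (k : Fin n → ℕ) : ℂ := (-1) ^ ∑ b, (k b + b + 1)

/-- `interleaveMatrix` unfolded. [folklore] -/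
@[simp] theorem interleaveMatrix_apply (φ : List X → ℂ) {n : ℕ} (u v : Fin n → X)
    (k : Fin n → ℕ) (a b : Fin n) :
    interleaveMatrix φ u v k a b = if (a : ℕ) < k b then φ [u a, v b] else -φ [v b, u a] := rfl

/-- Sign bookkeeping, word starting with `v₀`: removing `v₀` and `u_a`. [folklore] -/
theorem interleaveSign_mul_of_zero {n : ℕ} {k : Fin (n + 1) → ℕ} (h00 : k 0 = 0)
    (a : Fin (n + 1)) :
    interleaveSign k * (-1) ^ (a : ℕ) =
      -((-1 : ℂ) ^ interleavePosU (Fin.tail k) a *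
        interleaveSign (fun b : Fin n => Fin.tail k b - if (a : ℕ) < Fin.tail k b then 1 else 0)) := by
  simp only [interleaveSign, interleavePosU]
  rw [← pow_add, ← pow_add]
  apply neg_one_pow_eq_neg_neg_one_pow_of_mod_two
  have hA : ∑ b : Fin (n + 1), (k b + b + 1) = 1 + ∑ b : Fin n, (Fin.tail k b + b + 2) := by
    rw [Fin.sum_univ_succ, h00]
    simp only [Fin.val_zero, add_zero, zero_add, Fin.val_succ]
    congr 1
  have hB : ∑ b : Fin n, (Fin.tail k b + b + 2) =
      ∑ b : Fin n, (Fin.tail k b - (if (a : ℕ) < Fin.tail k b then 1 else 0) + b + 1) +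
        ∑ b : Fin n, (1 + if (a : ℕ) < Fin.tail k b then 1 else 0) := by
    rw [← Finset.sum_add_distrib]
    exact Finset.sum_congr rfl fun b _ => by split_ifs <;> omega
  have hC : ∑ b : Fin n, (1 + if (a : ℕ) < Fin.tail k b then 1 else 0) =
      n + (univ.filter fun b : Fin n => (a : ℕ) < Fin.tail k b).card := by
    rw [Finset.sum_add_distrib, Finset.sum_const, card_univ, Fintype.card_fin, smul_eq_mul, mul_one,
      Finset.card_filter]
  have hD : (univ.filter fun b : Fin n => Fin.tail k b ≤ (a : ℕ)).card +
      (univ.filter fun b : Fin n => (a : ℕ) < Fin.tail k b).card = n := by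
    have := Finset.card_filter_add_card_filter_not
      (s := (univ : Finset (Fin n))) (fun b : Fin n => Fin.tail k b ≤ (a : ℕ))
    simp only [not_le, card_univ, Fintype.card_fin] at this
    exact this
  omega

/-- Sign bookkeeping, word starting with `u₀`: removing `u₀` and `v_b`. [folklore] -/
theorem interleaveSign_mul_of_ne_zero {n : ℕ} {k : Fin (n + 1) → ℕ} (h1 : ∀ b, k b ≠ 0)
    (b : Fin (n + 1)) :
    interleaveSign k * (-1) ^ (b : ℕ) =
      (-1 : ℂ) ^ interleavePosV (fun b => k b - 1) b *
        interleaveSign (fun b' : Fin n => k (b.succAbove b') - 1) := by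
  simp only [interleaveSign, interleavePosV]
  rw [← pow_add, ← pow_add]
  apply neg_one_pow_eq_neg_one_pow_of_mod_two
  have hA : ∑ b₁ : Fin (n + 1), (k b₁ + b₁ + 1) =
      (k b + b + 1) + ∑ b' : Fin n, (k (b.succAbove b') + (b.succAbove b' : ℕ) + 1) :=
    Fin.sum_univ_succAbove _ b
  have hB : ∑ b' : Fin n, (k (b.succAbove b') + (b.succAbove b' : ℕ) + 1) =
      ∑ b' : Fin n, (k (b.succAbove b') - 1 + b' + 1) +
        ∑ b' : Fin n, (1 + if (b' : ℕ) < b then 0 else 1) := by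
    rw [← Finset.sum_add_distrib]
    refine Finset.sum_congr rfl fun b' _ => ?_
    have := h1 (b.succAbove b')
    rw [val_succAbove_eq_ite]
    split_ifs <;> omega
  have hC : ∑ b' : Fin n, (1 + if (b' : ℕ) < b then 0 else 1) =
      n + (univ.filter fun b' : Fin n => ¬ (b' : ℕ) < b).card := by
    rw [Finset.sum_add_distrib, Finset.sum_const, card_univ, Fintype.card_fin, smul_eq_mul, mul_one,
      Finset.card_filter]
    congr 1
    exact Finset.sum_congr rfl fun b' _ => by split_ifs <;> simp_all
  have hD : (univ.filter fun b' : Fin n => (b' : ℕ) < b).card +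
      (univ.filter fun b' : Fin n => ¬ (b' : ℕ) < b).card = n := by
    have := Finset.card_filter_add_card_filter_not
      (s := (univ : Finset (Fin n))) (fun b' : Fin n => (b' : ℕ) < b)
    simp only [card_univ, Fintype.card_fin] at this
    exact this
  have hE : (univ.filter fun b' : Fin n => (b' : ℕ) < b).card = b := by
    rw [Finset.card_filter, Fin.sum_univ_eq_sum_range (fun x => if x < (b : ℕ) then 1 else 0) n,
      ← Finset.card_filter]
    have hb := b.isLt
    have : (range n).filter (fun x => x < (b : ℕ)) = range b := by
      ext x
      simp only [mem_filter, mem_range]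
      omega
    rw [this, card_range]
  have := h1 b
  omega

/-- Relabelling the rows after deleting `u_a`. [folklore] -/
theorem val_succAbove_lt_iff {n : ℕ} (a : Fin (n + 1)) (a' : Fin n) (K : ℕ) :
    ((a.succAbove a' : Fin (n + 1)) : ℕ) < K ↔ (a' : ℕ) < K - if (a : ℕ) < K then 1 else 0 := by
  rw [val_succAbove_eq_ite]
  split_ifs <;> omega

/-- **The determinant formula for a Gaudin functional.** Let `φ` be a functional on words
satisfying Gaudin's recursion `φ(x w) = Σ_r (-1)^r φ(x w_r) φ(w ∖ w_r)` for words `w` of odd length,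
`φ(∅) = 1`, and let `u`, `v` be two families of letters whose equal-kind contractions vanish
(`φ(u_a u_{a'}) = φ(v_b v_{b'}) = 0`). Then for every interleaving of `u₀,…,u_{n-1}` with
`v₀,…,v_{n-1}` (data `k`, `k_b` = number of `u`'s before `v_b`),
`φ(word) = (-1)^{Σ_b (k_b + b + 1)} · det [ u_a before v_b ? φ(u_a v_b) : -φ(v_b u_a) ]_{a,b}`
— the iterated Wick/Gaudin recursion is a Laplace expansion. Gaudin, Nucl. Phys. 15 (1960) 89
(the formula for `⟨α₁ ⋯ α_{2n}⟩`); Bratteli–Robinson II §5.2.4. [cite: Gaudin1960] -/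
theorem gaudinFunctional_interleaveWord_eq_sign_mul_det (φ : List X → ℂ)
    (hG : ∀ (x : X) (w : List X), Odd w.length →
      φ (x :: w) = fermiWickSum (fun a l => φ [x, a] * φ l) [] w)
    (h0 : φ [] = 1) :
    ∀ (n : ℕ) (u v : Fin n → X), (∀ a a', φ [u a, u a'] = 0) → (∀ b b', φ [v b, v b'] = 0) →
      ∀ k : Fin n → ℕ, Monotone k → (∀ b, k b ≤ n) →
        φ (interleaveWord n n u v k) = interleaveSign k * (interleaveMatrix φ u v k).det
  | 0, u, v, _, _, k, _, _ => by simp [interleaveSign, h0]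
  | n + 1, u, v, huu, hvv, k, hmono, hk => by
    by_cases h00 : k 0 = 0
    · -- the word starts with `v 0`: Laplace expansion along the first column
      have hodd : Odd (interleaveWord (n + 1) n u (Fin.tail v) (Fin.tail k)).length := by
        rw [length_interleaveWord]; exact ⟨n, by ring⟩
      rw [interleaveWord_consV u v h00, hG _ _ hodd, fermiWickSum_interleaveWord _ (n + 1) n u (Fin.tail v)
        (Fin.tail k) (monotone_fin_tail hmono) (fun b => hk b.succ) []]
      have hV : ∑ b : Fin n, (-1 : ℤ) ^ interleavePosV (Fin.tail k) b •
          (φ [v 0, Fin.tail v b] * φ ([] ++ interleaveDelV (n + 1) n u (Fin.tail v) (Fin.tail k) b)) =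
          0 := Finset.sum_eq_zero fun b _ => by rw [Fin.tail, hvv, zero_mul, smul_zero]
      rw [hV, zero_add, Matrix.det_succ_column_zero, Finset.mul_sum]
      refine Finset.sum_congr rfl fun a _ => ?_
      -- the reduced interleaving data
      set k'' : Fin n → ℕ := fun b => Fin.tail k b - if (a : ℕ) < Fin.tail k b then 1 else 0 with hk''
      have hmono'' : Monotone k'' := by
        intro b₁ b₂ hb
        have := monotone_fin_tail hmono hb
        simp only [hk'', Fin.tail] at this ⊢
        split_ifs <;> omega
      have hbd'' : ∀ b, k'' b ≤ n := fun b => by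
        have := hk b.succ
        have := a.isLt
        simp only [hk'', Fin.tail]
        split_ifs <;> omega
      have ih := gaudinFunctional_interleaveWord_eq_sign_mul_det φ hG h0 n (fun a' => u (a.succAbove a'))
        (Fin.tail v) (fun _ _ => huu _ _) (fun _ _ => hvv _ _) k'' hmono'' hbd''
      have hM0 : interleaveMatrix φ u v k a 0 = -φ [v 0, u a] := by
        simp [interleaveMatrix, h00]
      have hsub : (interleaveMatrix φ u v k).submatrix a.succAbove Fin.succ =
          interleaveMatrix φ (fun a' => u (a.succAbove a')) (Fin.tail v) k'' := by
        ext a' b'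
        simp only [submatrix_apply, interleaveMatrix_apply, hk'', Fin.tail, val_succAbove_lt_iff]
        split_ifs <;> rfl
      rw [List.nil_append, interleaveDelU_succ, ih, hM0, hsub, zsmul_eq_mul, Int.cast_pow,
        Int.cast_neg, Int.cast_one,
        show interleaveSign k * ((-1) ^ (a : ℕ) * -φ [v 0, u a] *
            (interleaveMatrix φ (fun a' => u (a.succAbove a')) (Fin.tail v) k'').det) =
          interleaveSign k * (-1) ^ (a : ℕ) * -φ [v 0, u a] *
            (interleaveMatrix φ (fun a' => u (a.succAbove a')) (Fin.tail v) k'').det by ring,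
        interleaveSign_mul_of_zero h00 a]
      ring
    · -- the word starts with `u 0`: Laplace expansion along the first row
      have h1 : ∀ b, k b ≠ 0 := fun b =>
        Nat.one_le_iff_ne_zero.mp ((Nat.one_le_iff_ne_zero.mpr h00).trans (hmono (Fin.zero_le b)))
      have hodd : Odd (interleaveWord n (n + 1) (Fin.tail u) v (fun b => k b - 1)).length := by
        rw [length_interleaveWord]; exact ⟨n, by ring⟩
      rw [interleaveWord_consU u v h1, hG _ _ hodd, fermiWickSum_interleaveWord _ n (n + 1) (Fin.tail u) v
        (fun b => k b - 1) (fun a b hab => Nat.sub_le_sub_right (hmono hab) 1)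
        (fun b => by have := hk b; omega) []]
      have hU : ∑ a : Fin n, (-1 : ℤ) ^ interleavePosU (fun b => k b - 1) a •
          (φ [u 0, Fin.tail u a] *
            φ ([] ++ interleaveDelU n (n + 1) (Fin.tail u) v (fun b => k b - 1) a)) = 0 :=
        Finset.sum_eq_zero fun a _ => by rw [Fin.tail, huu, zero_mul, smul_zero]
      rw [hU, add_zero, Matrix.det_succ_row_zero, Finset.mul_sum]
      refine Finset.sum_congr rfl fun b _ => ?_
      set k'' : Fin n → ℕ := fun b' => k (b.succAbove b') - 1 with hk''
      have hmono'' : Monotone k'' := fun b₁ b₂ hb =>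
        Nat.sub_le_sub_right (hmono ((Fin.strictMono_succAbove b).monotone hb)) 1
      have hbd'' : ∀ b', k'' b' ≤ n := fun b' => by
        have := hk (b.succAbove b')
        simp only [hk'']
        omega
      have ih := gaudinFunctional_interleaveWord_eq_sign_mul_det φ hG h0 n (Fin.tail u)
        (fun b' => v (b.succAbove b')) (fun _ _ => huu _ _) (fun _ _ => hvv _ _) k'' hmono'' hbd''
      have hM0 : interleaveMatrix φ u v k 0 b = φ [u 0, v b] := by
        simp [interleaveMatrix, Nat.pos_of_ne_zero (h1 b)]
      have hsub : (interleaveMatrix φ u v k).submatrix Fin.succ b.succAbove =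
          interleaveMatrix φ (Fin.tail u) (fun b' => v (b.succAbove b')) k'' := by
        ext a' b'
        simp only [submatrix_apply, interleaveMatrix_apply, hk'', Fin.tail, Fin.val_succ]
        have := h1 (b.succAbove b')
        by_cases hlt : (a' : ℕ) + 1 < k (b.succAbove b')
        · rw [if_pos hlt, if_pos (by omega)]
        · rw [if_neg hlt, if_neg (by omega)]
      rw [List.nil_append, interleaveDelV_succ, ih, hM0, hsub, zsmul_eq_mul, Int.cast_pow,
        Int.cast_neg, Int.cast_one,
        show interleaveSign k * ((-1) ^ (b : ℕ) * φ [u 0, v b] *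
            (interleaveMatrix φ (Fin.tail u) (fun b' => v (b.succAbove b')) k'').det) =
          interleaveSign k * (-1) ^ (b : ℕ) * φ [u 0, v b] *
            (interleaveMatrix φ (Fin.tail u) (fun b' => v (b.succAbove b')) k'').det by ring,
        interleaveSign_mul_of_ne_zero h1 b]
      ring

end GaudinFunctional

/-! ### Linear letters: smeared creation and annihilation operators -/

section LinLetter

variable {ι : Type*} [LinearOrder ι] [Fintype ι]

/-- A **linear letter**: a coefficient vector `f : ι → ℂ` and a type `b` (`true` = creation,
`false` = annihilation), standing for the smeared field `c^b(f) = Σ_i f_i c^b_i`.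
Bratteli–Robinson II §5.2.1 (`a*(f)`, `a(f)`; here both taken LINEAR in `f`). [folklore] -/
abbrev LinLetter (ι : Type*) : Type _ := (ι → ℂ) × Bool

/-- The operator of a linear letter, `c^b(f) = Σ_i f_i · letterOp (i, b)` (`Σ_i f_i c†_i` or
`Σ_i f_i c_i`). Bratteli–Robinson II §5.2.1. [folklore] -/
def linLetterOp (x : LinLetter ι) : Matrix (Finset ι) (Finset ι) ℂ :=
  ∑ i, x.1 i • letterOp (i, x.2)

/-- The operator of a word of linear letters (ordered product). [folklore] -/
def linWordOp (w : List (LinLetter ι)) : Matrix (Finset ι) (Finset ι) ℂ := (w.map linLetterOp).prod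

/-- `linWordOp [] = 1`. [folklore] -/
@[simp] theorem linWordOp_nil : linWordOp ([] : List (LinLetter ι)) = 1 := by simp [linWordOp]

/-- `linWordOp (x :: w) = linLetterOp x * linWordOp w`. [folklore] -/
theorem linWordOp_cons (x : LinLetter ι) (w : List (LinLetter ι)) :
    linWordOp (x :: w) = linLetterOp x * linWordOp w := by
  simp [linWordOp]

/-- `linWordOp (w₁ ++ w₂) = linWordOp w₁ * linWordOp w₂`. [folklore] -/
theorem linWordOp_append (w₁ w₂ : List (LinLetter ι)) :
    linWordOp (w₁ ++ w₂) = linWordOp w₁ * linWordOp w₂ := by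
  simp [linWordOp, List.prod_append]

/-- A basis letter is a linear letter: `linLetterOp (δ_i, b) = letterOp (i, b)`. [folklore] -/
theorem linLetterOp_single (i : ι) (b : Bool) :
    linLetterOp (Pi.single i 1, b) = letterOp (i, b) := by
  simp only [linLetterOp]
  rw [Finset.sum_eq_single i (fun j _ hj => by simp [hj]) (by simp)]
  simp

/-- Linearity of a word in its first letter, under a left weight and the trace. [folklore] -/
theorem trace_mul_linLetterOp_mul (W : Matrix (Finset ι) (Finset ι) ℂ) (x : LinLetter ι)
    (A : Matrix (Finset ι) (Finset ι) ℂ) :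
    (W * (linLetterOp x * A)).trace = ∑ i, x.1 i * (W * (letterOp (i, x.2) * A)).trace := by
  simp only [linLetterOp, Finset.sum_mul, Matrix.smul_mul, Matrix.mul_sum, Matrix.mul_smul,
    trace_sum, trace_smul, smul_eq_mul]

/-- The scalar anticommutator of two linear letters: `{c^b(f), c^{b'}(g)} = [b ≠ b'] Σ_i f_i g_i`.
Bratteli–Robinson II §5.2.1, (5.2.11)–(5.2.12). [folklore] -/
def linAnticomm (x y : LinLetter ι) : ℂ := if x.2 = y.2 then 0 else ∑ i, x.1 i * y.1 i

/-- **CAR for linear letters**: `c^b(f) c^{b'}(g) + c^{b'}(g) c^b(f) = {c^b(f), c^{b'}(g)} · 1`.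
Bratteli–Robinson II §5.2.1. [cite: BratteliRobinsonII1997, §5.2.1] -/
theorem linLetterOp_mul_add_mul (x y : LinLetter ι) :
    linLetterOp x * linLetterOp y + linLetterOp y * linLetterOp x =
      linAnticomm x y • (1 : Matrix (Finset ι) (Finset ι) ℂ) := by
  have h1 : linLetterOp x * linLetterOp y =
      ∑ i, ∑ j, (x.1 i * y.1 j) • (letterOp (i, x.2) * letterOp (j, y.2)) := by
    rw [linLetterOp, linLetterOp, Finset.sum_mul]
    refine Finset.sum_congr rfl fun i _ => ?_
    rw [Finset.mul_sum]
    refine Finset.sum_congr rfl fun j _ => ?_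
    rw [Matrix.smul_mul, Matrix.mul_smul, smul_smul]
  have h2 : linLetterOp y * linLetterOp x =
      ∑ i, ∑ j, (x.1 i * y.1 j) • (letterOp (j, y.2) * letterOp (i, x.2)) := by
    rw [linLetterOp, linLetterOp, Finset.sum_mul]
    simp_rw [Finset.mul_sum]
    rw [Finset.sum_comm]
    refine Finset.sum_congr rfl fun i _ => Finset.sum_congr rfl fun j _ => ?_
    rw [Matrix.smul_mul, Matrix.mul_smul, smul_smul, mul_comm]
  rw [h1, h2, ← Finset.sum_add_distrib]
  simp only [← Finset.sum_add_distrib, ← smul_add, letterOp_mul_add_mul, smul_smul,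
    ← Finset.sum_smul]
  congr 1
  simp only [letterAnticomm, linAnticomm, ne_eq]
  by_cases hb : x.2 = y.2
  · simp [hb]
  · simp [hb, Finset.sum_ite_eq]

/-- **Graded commutator of a linear letter with a word of linear letters**:
`c (a₀ ⋯ a_{m-1}) = Σ_k (-1)^k {c, a_k} a₀ ⋯ â_k ⋯ a_{m-1} + (-1)^m (a₀ ⋯ a_{m-1}) c`.
Gaudin, Nucl. Phys. 15 (1960) 89. [folklore] -/
theorem linLetterOp_mul_linWordOp (x : LinLetter ι) (pre w : List (LinLetter ι)) :
    linWordOp pre * (linLetterOp x * linWordOp w) =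
      fermiWickSum (fun a u => linAnticomm x a • linWordOp u) pre w +
        (-1 : ℤ) ^ w.length • (linWordOp pre * linWordOp w * linLetterOp x) := by
  induction w generalizing pre with
  | nil => simp
  | cons a w ih =>
    have hla : linLetterOp x * linLetterOp a = linAnticomm x a • 1 - linLetterOp a * linLetterOp x :=
      eq_sub_of_add_eq (linLetterOp_mul_add_mul x a)
    have ih' := ih (pre ++ [a])
    rw [linWordOp_append, linWordOp_cons, linWordOp_nil, mul_one] at ih'
    rw [linWordOp_cons, ← mul_assoc (linLetterOp x), hla, sub_mul, Matrix.smul_mul, Matrix.one_mul,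
      mul_sub, mul_assoc (linLetterOp a), ← mul_assoc (linWordOp pre) (linLetterOp a), ih']
    simp only [fermiWickSum_cons, linWordOp_append, List.length_cons, pow_succ, Matrix.mul_smul,
      mul_neg, mul_one, neg_smul, Matrix.mul_assoc]
    abel

/-- **Pull-through for linear letters (KMS)**: `c^b(f) e^{-βdΓ(h)} = e^{-βdΓ(h)} c^b(f P⁽ᵇ⁾)` with
the pull-through matrix `P⁽ᵇ⁾` of `FermionQuasiFreeWick` (`(e^{βh})ᵀ` resp. `e^{-βh}`).
Gaudin, Nucl. Phys. 15 (1960) 89. [cite: Gaudin1960] -/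
theorem linLetterOp_mul_gibbsWeight_dGamma (β : ℝ) (h : Matrix ι ι ℂ) (x : LinLetter ι) :
    linLetterOp x * gibbsWeight β (dGamma h) =
      gibbsWeight β (dGamma h) * linLetterOp (x.1 ᵥ* pullMatrix β h x.2, x.2) := by
  obtain ⟨f, b⟩ := x
  simp only [linLetterOp, Finset.sum_mul, Matrix.smul_mul, letterOp_mul_gibbsWeight_dGamma,
    Finset.smul_sum, smul_smul, Matrix.mul_sum, Matrix.mul_smul, Matrix.vecMul, dotProduct,
    Finset.sum_smul]
  rw [Finset.sum_comm]

/-- **Gaudin's linear system for linear letters.** With `W = e^{-βdΓ(h)}`, `T(X) = tr (W X)`: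
`T(c^b(f) w) - (-1)^{|w|} T(c^b(f P⁽ᵇ⁾) w) = Σ_k (-1)^k {c^b(f), w_k} T(w ∖ w_k)`.
Gaudin, Nucl. Phys. 15 (1960) 89. [cite: Gaudin1960] -/
theorem gaudin_linear_system_lin (β : ℝ) (h : Matrix ι ι ℂ) (x : LinLetter ι)
    (w : List (LinLetter ι)) :
    (gibbsWeight β (dGamma h) * (linLetterOp x * linWordOp w)).trace -
        (-1 : ℤ) ^ w.length •
          (gibbsWeight β (dGamma h) *
            (linLetterOp (x.1 ᵥ* pullMatrix β h x.2, x.2) * linWordOp w)).trace =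
      fermiWickSum
        (fun a u => linAnticomm x a * (gibbsWeight β (dGamma h) * linWordOp u).trace) [] w := by
  set W := gibbsWeight β (dGamma h) with hW
  set T : Matrix (Finset ι) (Finset ι) ℂ →+ ℂ :=
    (Matrix.traceAddMonoidHom (Finset ι) ℂ).comp (AddMonoidHom.mulLeft W) with hT
  have hTapp : ∀ X, T X = (W * X).trace := fun X => rfl
  have hmove := linLetterOp_mul_linWordOp x [] w
  rw [linWordOp_nil, one_mul, one_mul] at hmove
  have h1 : T (linLetterOp x * linWordOp w) =
      fermiWickSum (fun a u => linAnticomm x a * (W * linWordOp u).trace) [] w +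
        (-1 : ℤ) ^ w.length • T (linWordOp w * linLetterOp x) := by
    rw [hmove, map_add, map_zsmul, map_fermiWickSum]
    simp only [hTapp, Matrix.mul_smul, trace_smul, smul_eq_mul]
  have h2 : T (linWordOp w * linLetterOp x) =
      (W * (linLetterOp (x.1 ᵥ* pullMatrix β h x.2, x.2) * linWordOp w)).trace := by
    rw [hTapp, ← Matrix.mul_assoc, trace_mul_cycle, hW, linLetterOp_mul_gibbsWeight_dGamma,
      Matrix.mul_assoc]
  rw [← hTapp, h1, h2, add_sub_cancel_right]

/-- **Gaudin's recursion for words of linear letters (un-normalised).** For Hermitian `h`, real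
`β`, a linear letter `x` and a word `w` of linear letters of odd length:
`Z · T(x w) = Σ_k (-1)^k T(x w_k) T(w ∖ w_k)`. Gaudin, Nucl. Phys. 15 (1960) 89 (the theorem is
stated there for arbitrary linear combinations `α_i` of creation and annihilation operators);
Bratteli–Robinson II §5.2.4. [cite: Gaudin1960] -/
theorem partitionFn_mul_trace_linLetterOp_mul_linWordOp {h : Matrix ι ι ℂ} (hh : h.IsHermitian)
    (β : ℝ) (x : LinLetter ι) {w : List (LinLetter ι)} (hw : Odd w.length) :
    partitionFn β (dGamma h) * (gibbsWeight β (dGamma h) * (linLetterOp x * linWordOp w)).trace =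
      fermiWickSum (fun a u => (gibbsWeight β (dGamma h) * (linLetterOp x * linLetterOp a)).trace *
        (gibbsWeight β (dGamma h) * linWordOp u).trace) [] w := by
  obtain ⟨f, b⟩ := x
  -- the unknowns `v_i = T(letterOp (i,b) w)` and two-point data `τ_i(a) = T(letterOp (i,b) a)`
  have key : ∀ i : ι, partitionFn β (dGamma h) *
      (gibbsWeight β (dGamma h) * (letterOp (i, b) * linWordOp w)).trace =
      fermiWickSum (fun a u => (gibbsWeight β (dGamma h) * (letterOp (i, b) * linLetterOp a)).trace *
        (gibbsWeight β (dGamma h) * linWordOp u).trace) [] w := by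
    refine gaudin_solve (isUnit_one_add_pullMatrix hh β b)
      (fun i a => (gibbsWeight β (dGamma h) * (letterOp (i, b) * linLetterOp a)).trace)
      (fun i a => linAnticomm (Pi.single i 1, b) a)
      (fun u => (gibbsWeight β (dGamma h) * linWordOp u).trace)
      (partitionFn β (dGamma h))
      (fun i => (gibbsWeight β (dGamma h) * (letterOp (i, b) * linWordOp w)).trace) w
      (fun a i' => ?_) (fun i' => ?_)
    · -- the two-point system: `gaudin_linear_system_lin` for the one-letter word `[a]`
      have := gaudin_linear_system_lin β h (Pi.single i' 1, b) [a]
      simp only [List.length_singleton, pow_one, neg_smul, one_smul, sub_neg_eq_add,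
        fermiWickSum_singleton, linWordOp_cons, linWordOp_nil, mul_one,
        linLetterOp_single, Matrix.single_one_vecMul, trace_mul_linLetterOp_mul,
        Matrix.row_apply] at this
      rw [this, partitionFn, mul_comm]
    · have := gaudin_linear_system_lin β h (Pi.single i' 1, b) w
      simp only [hw.neg_one_pow, neg_smul, one_smul, sub_neg_eq_add, linLetterOp_single,
        Matrix.single_one_vecMul, trace_mul_linLetterOp_mul, Matrix.row_apply] at this
      exact this
  -- resum over the coefficients `f`
  rw [trace_mul_linLetterOp_mul, Finset.mul_sum]
  simp_rw [mul_left_comm (partitionFn β (dGamma h)), key, ← fermiWickSum_const_mul,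
    ← fermiWickSum_finset_sum]
  refine fermiWickSum_congr (fun a u => ?_) [] w
  rw [trace_mul_linLetterOp_mul, Finset.sum_mul]
  simp only [mul_assoc]

/-- **Gaudin's recursion (the thermal Wick theorem) for words of linear letters, normalised
form.** For Hermitian `h`, real `β`, a linear letter `x` and a word `w = a₀ ⋯ a_{m-1}` of linear
letters of odd length, in the Gibbs state of `dΓ(h)`:
`⟨x a₀ ⋯ a_{m-1}⟩ = Σ_k (-1)^k ⟨x a_k⟩ ⟨a₀ ⋯ â_k ⋯ a_{m-1}⟩`. Since the imaginary-time evolved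
fields `e^{s dΓ(h)} c^±_i e^{-s dΓ(h)}` are linear letters (`FermionQuasiFree.lean`), this is the
time-dependent Wick rule of BGM 2006 §1.2 / (2.8). Gaudin, Nucl. Phys. 15 (1960) 89;
Bratteli–Robinson II §5.2.4. [cite: Gaudin1960] -/
theorem gibbsState_dGamma_linLetterOp_mul_linWordOp {h : Matrix ι ι ℂ} (hh : h.IsHermitian)
    (β : ℝ) (x : LinLetter ι) {w : List (LinLetter ι)} (hw : Odd w.length) :
    gibbsState β (dGamma h) (linLetterOp x * linWordOp w) =
      fermiWickSum (fun a u => gibbsState β (dGamma h) (linLetterOp x * linLetterOp a) *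
        gibbsState β (dGamma h) (linWordOp u)) [] w := by
  haveI : Nonempty (Finset ι) := ⟨∅⟩
  have hZ : partitionFn β (dGamma h) ≠ 0 := (partitionFn_pos β (isHermitian_dGamma hh)).ne'
  have key := partitionFn_mul_trace_linLetterOp_mul_linWordOp hh β x hw
  have hφ : ∀ (a : LinLetter ι) (u : List (LinLetter ι)),
      gibbsState β (dGamma h) (linLetterOp x * linLetterOp a) *
          gibbsState β (dGamma h) (linWordOp u) =
        ((partitionFn β (dGamma h))⁻¹ * (partitionFn β (dGamma h))⁻¹) *
          ((gibbsWeight β (dGamma h) * (linLetterOp x * linLetterOp a)).trace *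
            (gibbsWeight β (dGamma h) * linWordOp u).trace) := by
    intro a u
    simp only [gibbsState_apply]
    ring
  rw [fermiWickSum_congr hφ [] w, fermiWickSum_const_mul, ← key, gibbsState_apply, mul_assoc,
    inv_mul_cancel_left₀ hZ]

/-- Equal-type contractions of linear letters vanish: `⟨c^b(f) c^b(g)⟩ = 0` (gauge invariance
of the Gibbs state of `dΓ(h)`). Bratteli–Robinson II §5.2.4. [folklore] -/
theorem gibbsState_dGamma_linLetterOp_mul_linLetterOp_same {h : Matrix ι ι ℂ}
    (hh : h.IsHermitian) (β : ℝ) (f g : ι → ℂ) (b : Bool) :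
    gibbsState β (dGamma h) (linLetterOp (f, b) * linLetterOp (g, b)) = 0 := by
  rw [gibbsState_apply, trace_mul_linLetterOp_mul]
  simp [linLetterOp, Finset.mul_sum, trace_sum, trace_smul,
    trace_gibbsWeight_dGamma_letterOp_same hh]

/-- The Gibbs state of `dΓ(h)` on words of linear letters is a Gaudin functional, so the abstract
determinant formula applies: for families of smeared creation operators `c†(f_a)` and
annihilation operators `c(g_b)` in ANY interleaving (data `k`),
`⟨word⟩ = (-1)^{Σ_b (k_b+b+1)} det [ c†(f_a) before c(g_b) ? ⟨c†(f_a) c(g_b)⟩ : -⟨c(g_b) c†(f_a)⟩ ]`.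
Gaudin, Nucl. Phys. 15 (1960) 89; Bratteli–Robinson II §5.2.4. [cite: Gaudin1960] -/
theorem gibbsState_dGamma_linWordOp_interleaveWord {h : Matrix ι ι ℂ} (hh : h.IsHermitian) (β : ℝ)
    {n : ℕ} (f g : Fin n → ι → ℂ) (k : Fin n → ℕ) (hk : Monotone k) (hkn : ∀ b, k b ≤ n) :
    gibbsState β (dGamma h)
        (linWordOp (interleaveWord n n (fun a => (f a, true)) (fun b => (g b, false)) k)) =
      interleaveSign k *
        (Matrix.of fun a b : Fin n =>
          if (a : ℕ) < k b then
            gibbsState β (dGamma h) (linLetterOp (f a, true) * linLetterOp (g b, false))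
          else -gibbsState β (dGamma h) (linLetterOp (g b, false) * linLetterOp (f a, true))).det := by
  haveI : Nonempty (Finset ι) := ⟨∅⟩
  have hZ : partitionFn β (dGamma h) ≠ 0 := (partitionFn_pos β (isHermitian_dGamma hh)).ne'
  have hG : ∀ (x : LinLetter ι) (w : List (LinLetter ι)), Odd w.length →
      gibbsState β (dGamma h) (linWordOp (x :: w)) =
        fermiWickSum (fun a l => gibbsState β (dGamma h) (linWordOp [x, a]) *
          gibbsState β (dGamma h) (linWordOp l)) [] w := by
    intro x w hw
    simp only [linWordOp_cons, linWordOp_nil, mul_one]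
    exact gibbsState_dGamma_linLetterOp_mul_linWordOp hh β x hw
  have h0 : gibbsState β (dGamma h) (linWordOp []) = 1 := by simp [gibbsState_one β _ hZ]
  have huu : ∀ a a' : Fin n, gibbsState β (dGamma h) (linWordOp [(f a, true), (f a', true)]) = 0 :=
    fun a a' => by
      simp only [linWordOp_cons, linWordOp_nil, mul_one]
      exact gibbsState_dGamma_linLetterOp_mul_linLetterOp_same hh β _ _ true
  have hvv : ∀ b b' : Fin n, gibbsState β (dGamma h) (linWordOp [(g b, false), (g b', false)]) = 0 :=
    fun b b' => by
      simp only [linWordOp_cons, linWordOp_nil, mul_one]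
      exact gibbsState_dGamma_linLetterOp_mul_linLetterOp_same hh β _ _ false
  have key := gaudinFunctional_interleaveWord_eq_sign_mul_det
    (fun w => gibbsState β (dGamma h) (linWordOp w)) hG h0 n (fun a => (f a, true))
    (fun b => (g b, false)) huu hvv k hk hkn
  refine key.trans ?_
  have hM : interleaveMatrix (fun w => gibbsState β (dGamma h) (linWordOp w)) (fun a => (f a, true))
      (fun b => (g b, false)) k =
      Matrix.of fun a b : Fin n =>
        if (a : ℕ) < k b then
          gibbsState β (dGamma h) (linLetterOp (f a, true) * linLetterOp (g b, false))
        else -gibbsState β (dGamma h) (linLetterOp (g b, false) * linLetterOp (f a, true)) := by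
    ext a b
    simp only [interleaveMatrix_apply, Matrix.of_apply, linWordOp_cons, linWordOp_nil, mul_one]
  rw [hM]

/-- The alternating word `u₀ v₀ u₁ v₁ ⋯` is the interleaving with `k_b = b + 1`; as operators,
`linWordOp (u₀ v₀ u₁ v₁ ⋯) = ∏_p (u_p v_p)`. [folklore] -/
theorem linWordOp_interleaveWord_alternating {n : ℕ} (u v : Fin n → LinLetter ι) :
    linWordOp (interleaveWord n n u v fun b => (b : ℕ) + 1) =
      (List.ofFn fun p => linLetterOp (u p) * linLetterOp (v p)).prod := by
  induction n with
  | zero => simp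
  | succ n ih =>
    have hk : Fin.tail (fun b : Fin (n + 1) => (b : ℕ) + 1 - 1) = fun b : Fin n => (b : ℕ) + 1 := by
      funext b
      simp [Fin.tail]
    rw [interleaveWord_consU u v (fun b => Nat.succ_ne_zero _), interleaveWord_consV _ v (by simp), hk, linWordOp_cons,
      linWordOp_cons, ih, List.ofFn_succ, List.prod_cons, mul_assoc]
    rfl

/-- The alternating interleaving carries no sign. [folklore] -/
theorem interleaveSign_alternating (n : ℕ) : interleaveSign (fun b : Fin n => (b : ℕ) + 1) = 1 := by
  rw [interleaveSign]
  have : ∑ b : Fin n, ((b : ℕ) + 1 + b + 1) = 2 * ∑ b : Fin n, ((b : ℕ) + 1) := by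
    rw [Finset.mul_sum]
    exact Finset.sum_congr rfl fun b _ => by ring
  rw [this, pow_mul, neg_one_sq, one_pow]

/-- **Thermal Wick theorem in time-ordered determinant form (linear letters).** For Hermitian
`h`, real `β` and smeared operators `c†(f_p) = Σ_i (f_p)_i c†_i`, `c(g_p) = Σ_i (g_p)_i c_i`,
in the Gibbs state of `dΓ(h)`:
`⟨c†(f₀)c(g₀) c†(f₁)c(g₁) ⋯ c†(f_{n-1})c(g_{n-1})⟩ = det G`,
`G_{ab} = ⟨c†(f_a) c(g_b)⟩` for `a ≤ b` and `G_{ab} = -⟨c(g_b) c†(f_a)⟩` for `a > b`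
— the Pfaffian of Gaudin's theorem for an alternating, charge-balanced word is this determinant
(the ordering sign is the fermionic time-ordering sign of BGM 2006 (1.3)). Gaudin, Nucl. Phys. 15
(1960) 89; Bratteli–Robinson II §5.2.4; BGM 2006 §2.1 (2.8). [cite: Gaudin1960] -/
theorem gibbsState_dGamma_prod_linLetterOp_eq_det {h : Matrix ι ι ℂ} (hh : h.IsHermitian) (β : ℝ)
    {n : ℕ} (f g : Fin n → ι → ℂ) :
    gibbsState β (dGamma h)
        (List.ofFn fun p : Fin n => linLetterOp (f p, true) * linLetterOp (g p, false)).prod =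
      (Matrix.of fun a b : Fin n =>
          if a ≤ b then gibbsState β (dGamma h) (linLetterOp (f a, true) * linLetterOp (g b, false))
          else -gibbsState β (dGamma h) (linLetterOp (g b, false) * linLetterOp (f a, true))).det := by
  have := gibbsState_dGamma_linWordOp_interleaveWord hh β f g (fun b => (b : ℕ) + 1)
    (fun a b hab => Nat.succ_le_succ (Fin.le_def.mp hab)) (fun b => b.isLt)
  rw [linWordOp_interleaveWord_alternating, interleaveSign_alternating, one_mul] at this
  rw [this]
  congr 1
  ext a b
  simp only [Matrix.of_apply, Nat.lt_succ_iff, Fin.le_def]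

end LinLetter

/-! ### The time-ordered Wick theorem for imaginary-time evolved fields -/

section TimeOrdered

variable {ι : Type*} [LinearOrder ι] [Fintype ι]

/-- An evolved creation operator is a linear letter:
`e^{s dΓ(h)} c†_i e^{-s dΓ(h)} = c†(k ↦ (e^{sh})_{ki})`. BGM 2006 §1.2 (1.2). [folklore] -/
theorem exp_dGamma_conj_creation_eq_linLetterOp (h : Matrix ι ι ℂ) (s : ℂ) (i : ι) :
    exp (s • dGamma h) * creation i * exp (-(s • dGamma h)) =
      linLetterOp (fun k => exp (s • h) k i, true) := by
  rw [exp_dGamma_mul_creation_mul_exp_neg]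
  simp [linLetterOp, letterOp]

/-- An evolved annihilation operator is a linear letter:
`e^{s dΓ(h)} c_j e^{-s dΓ(h)} = c(k ↦ (e^{-sh})_{jk})`. BGM 2006 §1.2 (1.2). [folklore] -/
theorem exp_dGamma_conj_annihilation_eq_linLetterOp (h : Matrix ι ι ℂ) (s : ℂ) (j : ι) :
    exp (s • dGamma h) * annihilation j * exp (-(s • dGamma h)) =
      linLetterOp (fun k => exp (-(s • h)) j k, false) := by
  rw [exp_dGamma_mul_annihilation_mul_exp_neg]
  simp [linLetterOp, letterOp]

/-- **The time-ordered thermal Wick theorem (BGM's "Wick rule" with the free propagator).**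
For Hermitian `h`, real `β`, orbitals `i_p, j_p` and complex times `s_p, t_p`, with the evolved
fields `a⁺_i(s) = e^{s dΓ(h)} c†_i e^{-s dΓ(h)}`, `a⁻_j(t) = e^{t dΓ(h)} c_j e^{-t dΓ(h)}`:
`⟨a⁺_{i₀}(s₀)a⁻_{j₀}(t₀) ⋯ a⁺_{i_{n-1}}(s_{n-1})a⁻_{j_{n-1}}(t_{n-1})⟩_β = det G`, where
`G_{ab} = ⟨a⁺_{i_a}(s_a) a⁻_{j_b}(t_b)⟩ = [e^{-t_b h}(1+e^{βh})⁻¹e^{s_a h}]_{j_b i_a}` for `a ≤ b` and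
`G_{ab} = -⟨a⁻_{j_b}(t_b) a⁺_{i_a}(s_a)⟩ = -[e^{-t_b h}(1+e^{-βh})⁻¹e^{s_a h}]_{j_b i_a}` for `a > b`,
i.e. `G_{ab} = -g(𝐱_b - 𝐲_a)` with BGM's time-ordered free propagator `g` (1.3)–(1.4) when the
times decrease along the word. This is the algebraic content of the determinant /
Grassmann representation (2.6)–(2.8) of BGM 2006 §2.1 at every order. Gaudin, Nucl. Phys. 15
(1960) 89; BGM 2006 §1.2, §2.1. [cite: BenfattoGiulianiMastropietro2006, §2.1 (2.8)] -/
theorem gibbsState_dGamma_prod_evolved_eq_det {h : Matrix ι ι ℂ} (hh : h.IsHermitian) (β : ℝ)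
    {n : ℕ} (i j : Fin n → ι) (s t : Fin n → ℂ) :
    gibbsState β (dGamma h)
        (List.ofFn fun p : Fin n =>
          (exp (s p • dGamma h) * creation (i p) * exp (-(s p • dGamma h))) *
            (exp (t p • dGamma h) * annihilation (j p) * exp (-(t p • dGamma h)))).prod =
      (Matrix.of fun a b : Fin n =>
          if a ≤ b then (exp (-(t b • h)) * (1 + exp ((β : ℂ) • h))⁻¹ * exp (s a • h)) (j b) (i a)
          else -(exp (-(t b • h)) * (1 + exp (-((β : ℂ) • h)))⁻¹ * exp (s a • h)) (j b) (i a)).det := by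
  simp only [exp_dGamma_conj_creation_eq_linLetterOp, exp_dGamma_conj_annihilation_eq_linLetterOp]
  rw [gibbsState_dGamma_prod_linLetterOp_eq_det hh β]
  congr 1
  ext a b
  simp only [Matrix.of_apply]
  split_ifs
  · rw [← exp_dGamma_conj_creation_eq_linLetterOp, ← exp_dGamma_conj_annihilation_eq_linLetterOp]
    exact thermalCorr_dGamma_evolve_creation_annihilation hh β (t b) (s a) (i a) (j b)
  · rw [← exp_dGamma_conj_creation_eq_linLetterOp, ← exp_dGamma_conj_annihilation_eq_linLetterOp]
    exact congrArg Neg.neg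
      (thermalCorr_dGamma_evolve_annihilation_creation hh β (t b) (s a) (i a) (j b))

/-- **Equal-time special case: products of pairs `c†_{i_p} c_{j_p}` (e.g. densities).** For
Hermitian `h` and real `β`, in the Gibbs state of `dΓ(h)`:
`⟨(c†_{i₀}c_{j₀})(c†_{i₁}c_{j₁})⋯(c†_{i_{n-1}}c_{j_{n-1}})⟩ = det G` with
`G_{ab} = ⟨c†_{i_a} c_{j_b}⟩ = [(1+e^{βh})⁻¹]_{j_b i_a}` for `a ≤ b` and
`G_{ab} = -⟨c_{j_b} c†_{i_a}⟩ = [(1+e^{βh})⁻¹]_{j_b i_a} - δ_{i_a j_b}` for `a > b`; in particular the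
density correlations `⟨n_{x₁} ⋯ n_{x_n}⟩` of the ideal Fermi gas. Gaudin, Nucl. Phys. 15 (1960) 89;
Bratteli–Robinson II §5.2.4. [cite: Gaudin1960] -/
theorem gibbsState_dGamma_prod_creation_mul_annihilation_eq_det {h : Matrix ι ι ℂ}
    (hh : h.IsHermitian) (β : ℝ) {n : ℕ} (i j : Fin n → ι) :
    gibbsState β (dGamma h) (List.ofFn fun p : Fin n => creation (i p) * annihilation (j p)).prod =
      (Matrix.of fun a b : Fin n =>
          if a ≤ b then (1 + exp ((β : ℂ) • h))⁻¹ (j b) (i a)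
          else (1 + exp ((β : ℂ) • h))⁻¹ (j b) (i a) - (1 : Matrix ι ι ℂ) (i a) (j b)).det := by
  have := gibbsState_dGamma_prod_evolved_eq_det hh β i j (fun _ => 0) (fun _ => 0)
  simp only [zero_smul, neg_zero, exp_zero, Matrix.one_mul, Matrix.mul_one] at this
  rw [this]
  congr 1
  ext a b
  simp only [Matrix.of_apply]
  split_ifs with hab
  · rfl
  · have h1 := thermalCorr_dGamma_annihilation_creation hh β (i a) (j b)
    have h2 := thermalCorr_dGamma_annihilation_creation' hh β (i a) (j b)
    rw [h2] at h1
    rw [h1]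
    ring

end TimeOrdered

end Literature.MathematicalPhysics.QuantumLattice
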